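import Summits.CriticalPhenomena.CardyFormulaZ2.Theorems.CardyBoundaryCoulombGasBoundaryDefectGaussianRStubTransferPart3

/-!
# Stub `stub_transfer` of line `rainbow-monomials-in-excursion-kernels` — Part 4: conformal
# geometry at a flat boundary point, II (crux `CardyBoundaryCoulombGas.BoundaryDefectGaussianR`,
# stmt-CriticalPhenomena-14132)

* `transfer_deriv_ne_zero` — if an open half-ball at the boundary point `b` lies in `Ω`,
  `Im w > 0` on `Ω`, `Im w(b) = 0`, `w` analytic at `b` and injective on `Ω`, then `w′(b) ≠ 0`:
  writing `w − w(b) = (z − b)^n g` with `g(b) ≠ 0`, positivity of `Im w` on the half-ball forces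
  `Im (ζ^n ν^n g(b)) ≥ 0` for every direction `ζ` of the closed half-circle on the `Ω` side, which
  is impossible for `n ≥ 2` (the `n`-th powers of a closed half-circle cover the circle).
* `transfer_local_preimage` / `transfer_boundary_injective` — at two distinct such boundary points
  with `w′ ≠ 0` the values of `w` differ: by the inverse function theorem every point of `ℍ` near
  the common value would have preimages in `Ω` near both points, contradicting injectivity.

All [folklore]; Mathlib: `AnalyticAt.exists_eventuallyEq_pow_smul_nonzero_iff`,
`HasStrictFDerivAt.toOpenPartialHomeomorph`.
-/

noncomputable section

open Filter Topology Set

namespace Summit.CriticalPhenomena.CardyFormulaZ2.Cruxes.BoundaryDefectGaussianR.RainbowMonomialsInExcursionKernels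

/-- **Non-vanishing derivative at a flat boundary point.** See the module docstring. [folklore] -/
theorem transfer_deriv_ne_zero {Ω : Set ℂ} {w : ℂ → ℂ} {b ν : ℂ} {r : ℝ} (hν : ‖ν‖ = 1)
    (hr : 0 < r) (hH : ∀ z, dist z b < r → 0 < ((z - b) / ν).re → z ∈ Ω)
    (hpos : ∀ z ∈ Ω, 0 < (w z).im) (hwb : (w b).im = 0) (han : AnalyticAt ℂ w b)
    (hinj : Set.InjOn w Ω) : deriv w b ≠ 0 := by
  have hν0 : ν ≠ 0 := fun h ↦ by simp [h] at hν
  -- points of the inside ray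
  have hray : ∀ t : ℝ, 0 < t → t < r → b + (t : ℂ) * ν ∈ Ω := by
    intro t ht htr
    refine hH _ ?_ ?_
    · rw [dist_eq_norm, add_sub_cancel_left, norm_mul, Complex.norm_real, hν, mul_one,
        Real.norm_eq_abs, abs_of_pos ht]
      exact htr
    · rw [add_sub_cancel_left, mul_div_assoc, div_self hν0, mul_one, Complex.ofReal_re]
      exact ht
  -- `w - w b` is not identically zero near `b`
  have hnc : ¬ (∀ᶠ z in 𝓝 b, w z - w b = 0) := by
    intro h
    obtain ⟨ε, hε, hball⟩ := Metric.mem_nhds_iff.mp h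
    have hp : ∀ t : ℝ, 0 < t → t < min ε r → b + (t : ℂ) * ν ∈ Ω ∧ w (b + (t : ℂ) * ν) = w b := by
      intro t ht htε
      refine ⟨hray t ht (lt_of_lt_of_le htε (min_le_right ε r)), sub_eq_zero.mp (hball ?_)⟩
      rw [Metric.mem_ball, dist_eq_norm, add_sub_cancel_left, norm_mul, Complex.norm_real, hν,
        mul_one, Real.norm_eq_abs, abs_of_pos ht]
      exact lt_of_lt_of_le htε (min_le_left ε r)
    have hm : 0 < min ε r := lt_min hε hr
    have h1 := hp (min ε r / 2) (by positivity) (by linarith)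
    have h2 := hp (min ε r / 4) (by positivity) (by linarith)
    have heq := hinj h1.1 h2.1 (h1.2.trans h2.2.symm)
    have h3 : ((min ε r / 2 : ℝ) : ℂ) * ν = ((min ε r / 4 : ℝ) : ℂ) * ν := add_left_cancel heq
    have h4 : ((min ε r / 2 : ℝ) : ℂ) = ((min ε r / 4 : ℝ) : ℂ) := mul_right_cancel₀ hν0 h3
    have h5 : (min ε r / 2 : ℝ) = min ε r / 4 := by exact_mod_cast h4
    linarith
  -- leading term of `w - w b` at `b`
  have han' : AnalyticAt ℂ (fun z ↦ w z - w b) b := han.sub analyticAt_const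
  obtain ⟨n, g, hg, hgb, hexp⟩ := han'.exists_eventuallyEq_pow_smul_nonzero_iff.mpr hnc
  have hn0 : n ≠ 0 := by
    rintro rfl
    have h0 : w b - w b = (b - b) ^ 0 • g b := hexp.self_of_nhds
    rw [sub_self, pow_zero, one_smul] at h0
    exact hgb h0.symm
  -- closed half-circle of directions: `Im (ζ^n ν^n g b) ≥ 0`
  have hclosed : ∀ ζ : ℂ, 0 ≤ ζ.re → 0 ≤ (ζ ^ n * (ν ^ n * g b)).im := by
    intro ζ hζ
    set z : ℝ → ℂ := fun s ↦ b + ν * ((s : ℂ) * ζ + (s : ℂ) ^ 2) with hz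
    have hzc : Continuous z := by
      rw [hz]
      fun_prop
    have hzt : Tendsto z (𝓝 0) (𝓝 b) := by
      have h := hzc.tendsto 0
      simpa [hz] using h
    have hgz : Tendsto (fun s ↦ g (z s)) (𝓝 (0 : ℝ)) (𝓝 (g b)) :=
      hg.continuousAt.tendsto.comp hzt
    have hpow : Tendsto (fun s : ℝ ↦ (ζ + (s : ℂ)) ^ n) (𝓝 0) (𝓝 (ζ ^ n)) := by
      have h : Continuous (fun s : ℝ ↦ (ζ + (s : ℂ)) ^ n) := by fun_prop
      simpa using h.tendsto 0
    have hFc : Tendsto (fun s : ℝ ↦ ν ^ n * ((ζ + (s : ℂ)) ^ n * g (z s))) (𝓝 0)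
        (𝓝 (ν ^ n * (ζ ^ n * g b))) := tendsto_const_nhds.mul (hpow.mul hgz)
    have hF : Tendsto (fun s : ℝ ↦ (ν ^ n * ((ζ + (s : ℂ)) ^ n * g (z s))).im) (𝓝[>] 0)
        (𝓝 ((ζ ^ n * (ν ^ n * g b)).im)) := by
      have h := (Complex.continuous_im.tendsto _).comp hFc
      rw [show ν ^ n * (ζ ^ n * g b) = ζ ^ n * (ν ^ n * g b) by ring] at h
      exact h.mono_left nhdsWithin_le_nhds
    have hev : ∀ᶠ s : ℝ in 𝓝[>] 0, 0 < (ν ^ n * ((ζ + (s : ℂ)) ^ n * g (z s))).im := by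
      have e1 : ∀ᶠ s : ℝ in 𝓝 0, w (z s) - w b = (z s - b) ^ n • g (z s) := hzt.eventually hexp
      have e2 : ∀ᶠ s : ℝ in 𝓝 0, dist (z s) b < r := Metric.tendsto_nhds.mp hzt r hr
      have e3 : ∀ᶠ s : ℝ in 𝓝[>] 0, s ∈ Set.Ioi 0 := eventually_mem_nhdsWithin
      filter_upwards [e1.filter_mono nhdsWithin_le_nhds, e2.filter_mono nhdsWithin_le_nhds, e3]
        with s h1 h2 h3
      have hs : 0 < s := h3
      have hzs : z s - b = ν * ((s : ℂ) * (ζ + (s : ℂ))) := by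
        simp only [hz]
        ring
      have hside : 0 < ((z s - b) / ν).re := by
        rw [hzs, mul_div_cancel_left₀ _ hν0, Complex.re_ofReal_mul, Complex.add_re,
          Complex.ofReal_re]
        exact mul_pos hs (by linarith)
      have hzΩ := hH (z s) h2 hside
      have him := hpos _ hzΩ
      have hfac : (z s - b) ^ n • g (z s) =
          ((s ^ n : ℝ) : ℂ) * (ν ^ n * ((ζ + (s : ℂ)) ^ n * g (z s))) := by
        rw [smul_eq_mul, hzs, mul_pow, mul_pow, Complex.ofReal_pow]
        ring
      have key : (w (z s)).im = s ^ n * (ν ^ n * ((ζ + (s : ℂ)) ^ n * g (z s))).im := by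
        have h := congrArg Complex.im h1
        rw [Complex.sub_im, hwb, sub_zero, hfac, Complex.im_ofReal_mul] at h
        exact h
      rw [key] at him
      exact (mul_pos_iff_of_pos_left (pow_pos hs n)).mp him
    exact ge_of_tendsto hF (hev.mono fun s hs ↦ hs.le)
  -- hence `n = 1`
  have hn1 : n = 1 := by
    by_contra hn1
    have hn2 : 2 ≤ n := by omega
    set d : ℂ := ν ^ n * g b with hd
    have hd0 : d ≠ 0 := mul_ne_zero (pow_ne_zero _ hν0) hgb
    have hdn : 0 < ‖d‖ := norm_pos_iff.mpr hd0
    set ω : ℂ := -Complex.I * (starRingEnd ℂ d) / (‖d‖ : ℂ) with hω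
    have hω1 : ‖ω‖ = 1 := by
      rw [hω, norm_div, norm_mul, norm_neg, Complex.norm_I, one_mul, Complex.norm_conj,
        Complex.norm_real, Real.norm_eq_abs, abs_of_pos hdn, div_self hdn.ne']
    have hωd : (ω * d).im = -‖d‖ := by
      have h1 : starRingEnd ℂ d * d = ((‖d‖ ^ 2 : ℝ) : ℂ) := by
        rw [mul_comm, Complex.mul_conj, Complex.normSq_eq_norm_sq]
      have h2 : ω * d = -Complex.I * (‖d‖ : ℂ) := by
        rw [hω, div_mul_eq_mul_div, mul_assoc, h1]
        push_cast
        field_simp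
      rw [h2]
      simp
    set θ : ℝ := Complex.arg ω / n with hθ
    set ζ : ℂ := Complex.exp ((θ : ℂ) * Complex.I) with hζ
    have hnpos : (0 : ℝ) < n := by exact_mod_cast (show 0 < n by omega)
    have hζn : ζ ^ n = ω := by
      rw [hζ, ← Complex.exp_nat_mul, hθ]
      have h : (n : ℂ) * (((Complex.arg ω / n : ℝ)) * Complex.I) = Complex.arg ω * Complex.I := by
        push_cast
        field_simp
      rw [h]
      have h2 := Complex.norm_mul_exp_arg_mul_I ω
      rwa [hω1, Complex.ofReal_one, one_mul] at h2
    have hζre : 0 ≤ ζ.re := by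
      rw [hζ, Complex.exp_ofReal_mul_I_re]
      have hn' : (2 : ℝ) ≤ n := by exact_mod_cast hn2
      have ha1 := Complex.neg_pi_lt_arg ω
      have ha2 := Complex.arg_le_pi ω
      apply Real.cos_nonneg_of_mem_Icc
      constructor
      · rw [hθ, le_div_iff₀ hnpos]
        nlinarith [Real.pi_pos]
      · rw [hθ, div_le_iff₀ hnpos]
        nlinarith [Real.pi_pos]
    have key := hclosed ζ hζre
    rw [hζn, hωd] at key
    linarith
  subst hn1
  -- and `deriv w b = g b ≠ 0`
  have hderiv : HasDerivAt w (g b) b := by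
    have h1 : HasDerivAt (fun z ↦ w b + (z - b) ^ 1 • g z) (g b) b := by
      have hg' := hg.differentiableAt.hasDerivAt
      have hlin : HasDerivAt (fun z : ℂ ↦ (z - b) ^ 1) 1 b := by
        simpa using (hasDerivAt_id b).sub_const b
      have h := (hlin.smul hg').const_add (w b)
      simpa using h
    refine h1.congr_of_eventuallyEq ?_
    filter_upwards [hexp] with z hz
    rw [← hz]
    ring
  rw [hderiv.deriv]
  exact hgb

/-- **Local preimages on the `Ω` side.** At a point `b ∈ closure Ω` where `w` has a non-zero
strict derivative, is real on `∂Ω` nearby and `Im w > 0` on `Ω`: every point of `ℍ` close to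
`w(b)` is the image of a point of `Ω` close to `b` (inverse function theorem; the preimage of a
small half-disc is connected, misses `∂Ω` and meets `Ω`). [folklore] -/
theorem transfer_local_preimage {Ω : Set ℂ} {w : ℂ → ℂ} (hΩ : IsOpen Ω)
    (hpos : ∀ z ∈ Ω, 0 < (w z).im) {b d : ℂ} (hb : b ∈ closure Ω) (hd : HasStrictDerivAt w d b)
    (hd0 : d ≠ 0) {r : ℝ} (hr : 0 < r) (hreal : ∀ z ∈ frontier Ω, dist z b < r → (w z).im = 0)
    {ρ : ℝ} (hρ : 0 < ρ) :
    ∃ η : ℝ, 0 < η ∧ ∀ y : ℂ, dist y (w b) < η → 0 < y.im → ∃ x ∈ Ω, dist x b < ρ ∧ w x = y := by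
  set e := (hd.hasStrictFDerivAt_equiv hd0).toOpenPartialHomeomorph w with he
  have hbs : b ∈ e.source := (hd.hasStrictFDerivAt_equiv hd0).mem_toOpenPartialHomeomorph_source
  have hcoe : ∀ x, e x = w x := fun x ↦ rfl
  have hwt : w b ∈ e.target := by rw [← hcoe]; exact e.map_source hbs
  -- continuity of the inverse at `w b`
  have hsymm : ContinuousAt e.symm (w b) := e.continuousAt_symm hwt
  have hsb : e.symm (w b) = b := by rw [← hcoe]; exact e.left_inv hbs
  obtain ⟨η₁, hη₁, hη₁t⟩ := Metric.isOpen_iff.mp e.open_target (w b) hwt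
  obtain ⟨η₂, hη₂, hη₂s⟩ := (Metric.tendsto_nhds_nhds.mp hsymm.tendsto) (min ρ r) (lt_min hρ hr)
  set η := min η₁ η₂ with hη
  have hη0 : 0 < η := lt_min hη₁ hη₂
  refine ⟨η, hη0, fun y hy hyim ↦ ?_⟩
  -- the half disc `N` and its preimage `S`
  set N : Set ℂ := Metric.ball (w b) η ∩ {y | 0 < y.im} with hN
  have hNt : N ⊆ e.target := fun y' hy' ↦ hη₁t (Metric.ball_subset_ball (min_le_left _ _) hy'.1)
  have hNpre : IsPreconnected N :=
    ((convex_ball (w b) η).inter (convex_halfSpace_im_gt 0)).isPreconnected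
  have hSpre : IsPreconnected (e.symm '' N) := hNpre.image _ (e.continuousOn_symm.mono hNt)
  have hSnear : ∀ x ∈ e.symm '' N, dist x b < min ρ r := by
    rintro x ⟨y', hy', rfl⟩
    rw [← hsb]
    exact hη₂s (lt_of_lt_of_le (Metric.mem_ball.mp hy'.1) (min_le_right _ _))
  have hSval : ∀ y' ∈ N, w (e.symm y') = y' := fun y' hy' ↦ by
    rw [← hcoe]; exact e.right_inv (hNt hy')
  have hSmiss : ∀ x ∈ e.symm '' N, x ∉ frontier Ω := by
    rintro x ⟨y', hy', rfl⟩ hxf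
    have h1 := hreal _ hxf (lt_of_lt_of_le (hSnear _ ⟨y', hy', rfl⟩) (min_le_right _ _))
    rw [hSval y' hy'] at h1
    exact absurd hy'.2 (by rw [Set.mem_setOf_eq, h1]; exact lt_irrefl 0)
  -- `S` meets `Ω`
  have hSmeet : (e.symm '' N ∩ Ω).Nonempty := by
    have hwc : ContinuousAt w b := hd.hasDerivAt.continuousAt
    have hnb : {x | dist (w x) (w b) < η} ∩ e.source ∈ 𝓝 b :=
      Filter.inter_mem (Metric.tendsto_nhds.mp hwc.tendsto η hη0) (e.open_source.mem_nhds hbs)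
    obtain ⟨x, ⟨hx1, hx2⟩, hxΩ⟩ := (mem_closure_iff_nhds.mp hb) _ hnb
    refine ⟨x, ⟨w x, ⟨hx1, hpos x hxΩ⟩, ?_⟩, hxΩ⟩
    rw [← hcoe]
    exact e.left_inv hx2
  have hSΩ : e.symm '' N ⊆ Ω := transfer_subset_of_preconnected hΩ hSpre hSmiss hSmeet
  have hyN : y ∈ N := ⟨hy, hyim⟩
  exact ⟨e.symm y, hSΩ ⟨y, hyN, rfl⟩,
    lt_of_lt_of_le (hSnear _ ⟨y, hyN, rfl⟩) (min_le_left _ _), hSval y hyN⟩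

/-- **Boundary injectivity.** Two distinct boundary points as in `transfer_local_preimage`, with
real boundary value at the first, have distinct `w`-values. [folklore] -/
theorem transfer_boundary_injective {Ω : Set ℂ} {w : ℂ → ℂ} (hΩ : IsOpen Ω)
    (hinj : Set.InjOn w Ω) (hpos : ∀ z ∈ Ω, 0 < (w z).im) {b₁ b₂ d₁ d₂ : ℂ} (hne : b₁ ≠ b₂)
    (hb₁ : b₁ ∈ closure Ω) (hb₂ : b₂ ∈ closure Ω) (hwb₁ : (w b₁).im = 0)
    (hd₁ : HasStrictDerivAt w d₁ b₁) (hd₁0 : d₁ ≠ 0)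
    (hd₂ : HasStrictDerivAt w d₂ b₂) (hd₂0 : d₂ ≠ 0) {r₁ r₂ : ℝ} (hr₁ : 0 < r₁) (hr₂ : 0 < r₂)
    (hreal₁ : ∀ z ∈ frontier Ω, dist z b₁ < r₁ → (w z).im = 0)
    (hreal₂ : ∀ z ∈ frontier Ω, dist z b₂ < r₂ → (w z).im = 0) : w b₁ ≠ w b₂ := by
  intro heq
  have hρ : 0 < dist b₁ b₂ / 2 := div_pos (dist_pos.mpr hne) two_pos
  obtain ⟨η₁, hη₁, h₁⟩ := transfer_local_preimage hΩ hpos hb₁ hd₁ hd₁0 hr₁ hreal₁ hρ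
  obtain ⟨η₂, hη₂, h₂⟩ := transfer_local_preimage hΩ hpos hb₂ hd₂ hd₂0 hr₂ hreal₂ hρ
  set y : ℂ := w b₁ + ((min η₁ η₂ / 2 : ℝ) : ℂ) * Complex.I with hy
  have hm : 0 < min η₁ η₂ := lt_min hη₁ hη₂
  have hdist : dist y (w b₁) = min η₁ η₂ / 2 := by
    rw [hy, dist_eq_norm, add_sub_cancel_left, norm_mul, Complex.norm_real, Complex.norm_I, mul_one,
      Real.norm_eq_abs, abs_of_pos (by positivity)]
  have hyim : 0 < y.im := by
    rw [hy, Complex.add_im, hwb₁, zero_add, Complex.mul_im, Complex.ofReal_re, Complex.ofReal_im,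
      Complex.I_re, Complex.I_im, mul_zero, mul_one, add_zero]
    positivity
  obtain ⟨x₁, hx₁Ω, hx₁b, hx₁y⟩ := h₁ y (by rw [hdist]; linarith [min_le_left η₁ η₂]) hyim
  obtain ⟨x₂, hx₂Ω, hx₂b, hx₂y⟩ := h₂ y (by rw [← heq, hdist]; linarith [min_le_right η₁ η₂]) hyim
  have hx : x₁ = x₂ := hinj hx₁Ω hx₂Ω (hx₁y.trans hx₂y.symm)
  subst hx
  have h := dist_triangle b₁ x₁ b₂
  rw [dist_comm b₁ x₁] at h
  linarith

/-- **Registered sub-goal `s6_derivNeZero` (Stub 6, geometry II).** At a boundary point `b`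
with an open half-ball of radius `r` on the side `ν` inside `Ω`, a map `w` analytic at `b`,
injective on `Ω`, with `Im w > 0` on `Ω` and `Im w(b) = 0` has `w′(b) ≠ 0`. [folklore] -/
theorem s6_derivNeZero :
    ∀ (Ω : Set ℂ) (w : ℂ → ℂ) (b ν : ℂ) (r : ℝ), ‖ν‖ = 1 → 0 < r → (∀ z, dist z b < r → 0 < ((z - b)
    / ν).re → z ∈ Ω) → (∀ z ∈ Ω, 0 < (w z).im) → (w b).im = 0 → AnalyticAt ℂ w b → Set.InjOn w Ω →
    deriv w b ≠ 0 :=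
  fun _ _ _ _ _ hν hr hH hpos hwb han hinj ↦ transfer_deriv_ne_zero hν hr hH hpos hwb han hinj

end Summit.CriticalPhenomena.CardyFormulaZ2.Cruxes.BoundaryDefectGaussianR.RainbowMonomialsInExcursionKernels

end
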